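import Summits.Ventures.Crystal3D.Theorems.StickyWulffConstantTextureBuildCoverPieces
import Summits.Ventures.Crystal3D.Theorems.StickyWulffConstantTextureBuildAtomic
import Summits.Ventures.Crystal3D.Theorems.StickyWulffConstantTextureLiminfTexShadowAdhesionDefs
import Summits.Ventures.Crystal3D.Theorems.StickyWulffConstantTextureLiminfTexShadowResolutionDefs
import HarnessLib

/-!
# TB-1: the CERTIFIED CELL COVER interface (freeze, part 1 — tents and wall cells) and THE TILING IDENTITY as a theorem
# (lane T, crux `TextureLiminfV5`, stmt-Ventures-23912; `stub_textureBuild` → TB-0.md §2.5 / §2 TB-C; cf-p1 DECISION (cxiii) «CellCover → TB-C», 2026-08-29T05:13:29Z)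

HONEST FRAMING. Venture `Summits/Ventures/Crystal3D` (cell `crystal3d-full`), route `route-Ventures-StickyWulffConstant`, helper `--supports` the
law-v5 crux `TextureLiminfV5` (stmt-Ventures-23912).  One DEFINITION (the cover structure) + pure finite combinatorics (census-free, standard axioms).  No
cover is constructed, no texture is built, no cell inequality is proved; rung F-C1 not moved.

* `CellCover C R₀ N x` — the filled configuration `x' ⊇ x` (`Def' ≤ Def`, TB-0.md (H3)), finitely many tent pieces (`TentPiece`, …TextureBuildCoverPieces) and
  placed wall cells (`PlacedCell C R₀ X'`) whose OWNED ball sets (real tent balls within `√2` of the free zone; the cell's balls) are pairwise disjoint subsets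
  of `X' = range x'`; `tilingLoss := Σ tent rims + Σ cell tiling rims`, `rimSum := Σ C(1+h_k)ρ_k`.
* **`CellCover.tiling`** (TB-C, `R₀ ≥ 1`): `Σ_f (tent f).budget + Σ_k (cell k).budget ≤ (6N' − C(x')) + tilingLoss` — the per-piece lines summed over the
  disjoint owned sets (`sum_halfDefect_le_contactDeficiency`) and `contactDeficiency (range x') = 6N' − C(x')`.
* `CellCover.chargeSum_le` — the wall law at `(C, R₀)` prices every cell: `chargeSum ≤ cellBudget + rimSum`.
* `CellCover.tentBudget_add_chargeSum_le` — the DISCRETE HALF of TB-0's level-2 composition: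
  `tentBudget + chargeSum ≤ (6N − C(x)) + tilingLoss + rimSum`.
* **`shadowTheoremSatAtomicV5_of_cover`** — THE LEVEL-2 COMPOSITION, parametric in the part-2 predicate `Good δ cv` (the region-partition clauses TB-D
  consumes, TB-0.md §7) and the gap cost `gap cv`: «TB-cover» (`BarlowResolution → BarlowAdhesionR →` for the wall law's `(C, R₀)`: every saturated
  near-optimal cluster has a `Good` cover with `tilingLoss + rimSum + gap ≤ θ·N^{2/3}`) + «TB-energy» (`PolytopeCalculus → BarlowFreeCertificate →` a `Good`
  cover yields a law-v5 texture with mass `≥ (1−δ)N` and `energy ≤ tentBudget + chargeSum + gap`) + the wall law `BilayerWallV5` ⇒ `ShadowTheoremSatAtomicV5`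
  (hence `stub_textureBuild` by `textureBuild_of_atomic`).  REAL proof; the two inputs become registrable stubs once part 2 defines `Good`.
WHAT THIS IS NOT: crust cells (`BarlowAdhesionR` budgets feeding `Q*` phantoms), the gap set `Γ` and the texture-side clauses of TB-D are NOT yet fields
(part 2); no cover is exhibited; F-C1 not moved.
-/

noncomputable section

open scoped BigOperators InnerProductSpace ENNReal
open MeasureTheory

namespace Summit.Ventures.Crystal3D.Cruxes.TextureLiminf.TexShadow

open Summit.Ventures.Crystal3D Summit.Ventures.Crystal3D.Theorems Finset
open Literature.MathematicalPhysics.StatisticalMechanics (IsHaggSeq fccStacking barlowStacking contactDeficiency orderedContacts)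

/-! ## The certified cell cover (part 1) and the tiling identity -/

/-- **CERTIFIED CELL COVER, part 1** (tents + wall cells): the filled configuration `x' ⊇ x` with no larger deficiency, finitely many tent pieces and placed
wall cells whose OWNED ball sets are pairwise disjoint subsets of the configuration.  (Crust cells, the gap set and the texture-side clauses: part 2.) -/
structure CellCover (C R₀ : ℝ) (N : ℕ) (x : Fin N → E3) where
  /-- the FILLED configuration (TB-0.md (H3)) -/
  N' : ℕ
  x' : Fin N' → E3
  hx' : IsUnitPacking x'
  hsub : Set.range x ⊆ Set.range x'
  hDef : 6 * (N' : ℝ) - (numContacts x' : ℝ) ≤ 6 * (N : ℝ) - (numContacts x : ℝ)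
  /-- tent pieces -/
  ng : ℕ
  tent : Fin ng → TentPiece
  /-- placed wall cells -/
  nk : ℕ
  cell : Fin nk → PlacedCell C R₀ (Finset.univ.image x')
  /-- ownership is exclusive -/
  hdisjTT : ∀ f g, f ≠ g → Disjoint ((tent f).owned (Finset.univ.image x')) ((tent g).owned (Finset.univ.image x'))
  hdisjTC : ∀ f k, Disjoint ((tent f).owned (Finset.univ.image x')) (cell k).act
  hdisjCC : ∀ k l, k ≠ l → Disjoint (cell k).act (cell l).act

namespace CellCover

variable {C R₀ : ℝ} {N : ℕ} {x : Fin N → E3}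

/-- the filled configuration as a finite set -/
def X' (cv : CellCover C R₀ N x) : Finset E3 := Finset.univ.image cv.x'

/-- total tent budget -/
def tentBudget (cv : CellCover C R₀ N x) : ℝ := ∑ f, (cv.tent f).budget

/-- total cell budget -/
def cellBudget (cv : CellCover C R₀ N x) : ℝ := ∑ k, (cv.cell k).budget

/-- total certified charge -/
def chargeSum (cv : CellCover C R₀ N x) : ℝ := ∑ k, (cv.cell k).charge

/-- total wall-law rim `Σ C(1+h_k)ρ_k` -/
def rimSum (cv : CellCover C R₀ N x) : ℝ := ∑ k, (cv.cell k).rim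

/-- the TILING LOSS: tent rims + cell tiling rims -/
def tilingLoss (cv : CellCover C R₀ N x) : ℝ :=
  ∑ f, (cv.tent f).rim cv.X' + ∑ k, (cv.cell k).tilingRim

/-- The filled configuration is a packing (Finset form). -/
theorem X'_sep (cv : CellCover C R₀ N x) : ∀ p ∈ cv.X', ∀ q ∈ cv.X', p ≠ q → 1 ≤ dist p q := by
  classical
  intro p hp q hq hpq
  unfold X' at hp hq
  obtain ⟨i, -, rfl⟩ := Finset.mem_image.1 hp
  obtain ⟨j, -, rfl⟩ := Finset.mem_image.1 hq
  exact cv.hx' (fun h => hpq (by rw [h]))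

/-- `D(X') = 6N' − C(x')`. -/
theorem contactDeficiency_X' (cv : CellCover C R₀ N x) :
    contactDeficiency cv.X' = 6 * (cv.N' : ℝ) - (numContacts cv.x' : ℝ) :=
  contactDeficiency_image_eq cv.x' cv.hx'.injective

/-- **THE TILING IDENTITY (TB-C)** for `R₀ ≥ 1`: `Σ tent budgets + Σ cell budgets ≤ (6N' − C(x')) + tilingLoss`. -/
theorem tiling (cv : CellCover C R₀ N x) (hR₀ : 1 ≤ R₀) :
    cv.tentBudget + cv.cellBudget ≤ (6 * (cv.N' : ℝ) - (numContacts cv.x' : ℝ)) + cv.tilingLoss := by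
  classical
  -- the owned sets: tents' owned balls and cells' actual balls, indexed by `Fin ng ⊕ Fin nk`
  set own : Fin cv.ng ⊕ Fin cv.nk → Finset E3 := fun i =>
    match i with
    | Sum.inl f => (cv.tent f).owned cv.X'
    | Sum.inr k => (cv.cell k).act with hown
  have hsub : ∀ i ∈ (Finset.univ : Finset (Fin cv.ng ⊕ Fin cv.nk)), own i ⊆ cv.X' := by
    rintro (f | k) -
    · exact (cv.tent f).owned_subset cv.X'
    · exact (cv.cell k).act_subset
  have hdisj : ∀ i ∈ (Finset.univ : Finset (Fin cv.ng ⊕ Fin cv.nk)), ∀ j ∈ (Finset.univ : Finset (Fin cv.ng ⊕ Fin cv.nk)),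
      i ≠ j → Disjoint (own i) (own j) := by
    rintro (f | k) - (g | l) - hne
    · exact cv.hdisjTT f g (fun h => hne (by rw [h]))
    · exact cv.hdisjTC f l
    · exact (cv.hdisjTC g k).symm
    · exact cv.hdisjCC k l (fun h => hne (by rw [h]))
  -- sum of half-defects over all owned sets ≤ D(X')
  have hhd : ∑ i, ∑ a ∈ own i, halfDefect cv.X' a ≤ contactDeficiency cv.X' := by
    rw [← Finset.sum_biUnion hdisj]
    exact sum_halfDefect_le_contactDeficiency cv.X' cv.X'_sep (Finset.biUnion_subset.2 hsub)
  rw [Fintype.sum_sum_type] at hhd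
  -- per-piece lines
  have htent : cv.tentBudget ≤ ∑ f, ∑ a ∈ (cv.tent f).owned cv.X', halfDefect cv.X' a + ∑ f, (cv.tent f).rim cv.X' := by
    unfold tentBudget
    rw [← Finset.sum_add_distrib]
    exact Finset.sum_le_sum fun f _ => (cv.tent f).budget_le cv.X'
  have hcell : cv.cellBudget ≤ ∑ k, ∑ a ∈ (cv.cell k).act, halfDefect cv.X' a + ∑ k, (cv.cell k).tilingRim := by
    unfold cellBudget
    rw [← Finset.sum_add_distrib]
    exact Finset.sum_le_sum fun k _ => (cv.cell k).budget_le hR₀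
  rw [← cv.contactDeficiency_X']
  unfold tilingLoss
  have hown₁ : ∑ f, ∑ a ∈ own (Sum.inl f), halfDefect cv.X' a = ∑ f, ∑ a ∈ (cv.tent f).owned cv.X', halfDefect cv.X' a := rfl
  have hown₂ : ∑ k, ∑ a ∈ own (Sum.inr k), halfDefect cv.X' a = ∑ k, ∑ a ∈ (cv.cell k).act, halfDefect cv.X' a := rfl
  linarith

/-- **Cells are priced by the wall law**: `chargeSum ≤ cellBudget + rimSum` from the `∀`-body of `BilayerWallCharged (13/25)` at `(C, R₀)`. -/
theorem chargeSum_le (cv : CellCover C R₀ N x)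
    (hW : ∀ (σ₁ σ₂ : ℤ → ℤ), IsHaggSeq σ₁ → IsHaggSeq σ₂ →
      ∀ (L₁ L₂ : E3 ≃ₗᵢ[ℝ] E3) (s₁ s₂ : E3) (A₁ A₂ : ℤ → (E3 ≃ₗᵢ[ℝ] E3)),
      (∀ i, ∃ u : E3, bilayer L₁ s₁ σ₁ i ⊆ (fun r => A₁ i r + u) '' fccRef) →
      (∀ j, ∃ u : E3, bilayer L₂ s₂ σ₂ j ⊆ (fun r => A₂ j r + u) '' fccRef) →
      ∀ (c : ℤ → ℤ → ℝ) (m : ℤ → ℤ → E3), (∀ i j, 0 ≤ c i j) → (∀ i j, c i j ≤ 13 / 25) →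
      (∀ i j, CoAx (A₁ i) (A₂ j) → A₁ i '' fccRef ≠ A₂ j '' fccRef →
        SharedAxis (m i j) (A₁ i) (A₂ j) ∧ c i j ≤ 1 / 2 * Real.sqrt (1 - ⟪m i j, e₃⟫_ℝ ^ 2)) →
      (∀ i j, A₁ i '' fccRef = A₂ j '' fccRef → c i j = 0) →
      BilayerWallAt C R₀ σ₁ σ₂ L₁ L₂ s₁ s₂ c) :
    cv.chargeSum ≤ cv.cellBudget + cv.rimSum := by
  unfold chargeSum cellBudget rimSum
  rw [← Finset.sum_add_distrib]
  exact Finset.sum_le_sum fun k _ => WallCell.charge_le hW (cv.cell k).toWallCell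

/-- **The discrete half of the level-2 composition**: `tentBudget + chargeSum ≤ (6N − C(x)) + tilingLoss + rimSum` (wall law at `(C, R₀)`, `R₀ ≥ 1`). -/
theorem tentBudget_add_chargeSum_le (cv : CellCover C R₀ N x) (hR₀ : 1 ≤ R₀)
    (hW : ∀ (σ₁ σ₂ : ℤ → ℤ), IsHaggSeq σ₁ → IsHaggSeq σ₂ →
      ∀ (L₁ L₂ : E3 ≃ₗᵢ[ℝ] E3) (s₁ s₂ : E3) (A₁ A₂ : ℤ → (E3 ≃ₗᵢ[ℝ] E3)),
      (∀ i, ∃ u : E3, bilayer L₁ s₁ σ₁ i ⊆ (fun r => A₁ i r + u) '' fccRef) →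
      (∀ j, ∃ u : E3, bilayer L₂ s₂ σ₂ j ⊆ (fun r => A₂ j r + u) '' fccRef) →
      ∀ (c : ℤ → ℤ → ℝ) (m : ℤ → ℤ → E3), (∀ i j, 0 ≤ c i j) → (∀ i j, c i j ≤ 13 / 25) →
      (∀ i j, CoAx (A₁ i) (A₂ j) → A₁ i '' fccRef ≠ A₂ j '' fccRef →
        SharedAxis (m i j) (A₁ i) (A₂ j) ∧ c i j ≤ 1 / 2 * Real.sqrt (1 - ⟪m i j, e₃⟫_ℝ ^ 2)) →
      (∀ i j, A₁ i '' fccRef = A₂ j '' fccRef → c i j = 0) →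
      BilayerWallAt C R₀ σ₁ σ₂ L₁ L₂ s₁ s₂ c) :
    cv.tentBudget + cv.chargeSum ≤ (6 * (N : ℝ) - (numContacts x : ℝ)) + cv.tilingLoss + cv.rimSum := by
  have h1 := cv.tiling hR₀
  have h2 := cv.chargeSum_le hW
  have h3 := cv.hDef
  linarith

/-- **THE LEVEL-2 COMPOSITION over the cover interface** (parametric in the part-2 predicate `Good` and the gap cost `gap`): «TB-cover» + «TB-energy» + the
wall law give the atomic-scale saturated shadow theorem.  `energy ≤ tent + charge + gap ≤ (6N − C(x)) + tilingLoss + rimSum + gap ≤ (6N − C(x)) + θN^{2/3}`. -/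
theorem shadowTheoremSatAtomicV5_of_cover
    (Good : ∀ {C R₀ : ℝ} {N : ℕ} {x : Fin N → E3}, ℝ → CellCover C R₀ N x → Prop)
    (gap : ∀ {C R₀ : ℝ} {N : ℕ} {x : Fin N → E3}, CellCover C R₀ N x → ℝ)
    (hcover : BarlowResolution → BarlowAdhesionR →
      ∀ C R₀ : ℝ, 1 ≤ R₀ → ∀ K δ θ : ℝ, 0 < δ → 0 < θ → ∃ N₀ : ℕ, ∀ N : ℕ, N₀ ≤ N → ∀ x : Fin N → E3, IsUnitPacking x →
        IsSaturated x → 6 * (N : ℝ) - (numContacts x : ℝ) ≤ K * (N : ℝ) ^ ((2 : ℝ) / 3) →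
        ∃ cv : CellCover C R₀ N x, Good δ cv ∧ cv.tilingLoss + cv.rimSum + gap cv ≤ θ * (N : ℝ) ^ ((2 : ℝ) / 3))
    (henergy : PolytopeCalculus → BarlowFreeCertificate →
      ∀ (C R₀ : ℝ) (N : ℕ) (x : Fin N → E3) (δ : ℝ) (cv : CellCover C R₀ N x), Good δ cv →
        ∃ (n : ℕ) (G : Fin n → Set E3) (A : Fin n → (E3 ≃ₗᵢ[ℝ] E3)) (c : Fin n → Fin n → ℝ) (m : Fin n → Fin n → E3),
          IsTexture (13 / 25) (1 / 2) n G A c m ∧ (1 - δ) * (N : ℝ) ≤ Real.sqrt 2 * vol n G ∧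
          energy n G A c m ≤ cv.tentBudget + cv.chargeSum + gap cv) :
    BarlowResolution → BarlowAdhesionR → BilayerWallV5 → PolytopeCalculus → BarlowFreeCertificate →
      ShadowTheoremSatAtomicV5 := by
  intro hres hadh hBW hpoly hfree _hG _hC _hNRG _hSL K δ θ hδ hθ
  obtain ⟨C, R₀, hR₀, hW⟩ := hBW
  obtain ⟨N₀, hN₀⟩ := hcover hres hadh C R₀ hR₀ K δ θ hδ hθ
  refine ⟨N₀, fun N hN x hx hsat hK => ?_⟩
  obtain ⟨cv, hgood, hslack⟩ := hN₀ N hN x hx hsat hK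
  obtain ⟨n, G, A, c, m, hT, hvol, hEn⟩ := henergy hpoly hfree C R₀ N x δ cv hgood
  refine ⟨n, G, A, c, m, hT, hvol, ?_⟩
  have hdisc := cv.tentBudget_add_chargeSum_le hR₀ hW
  linarith

end CellCover

end Summit.Ventures.Crystal3D.Cruxes.TextureLiminf.TexShadow

end
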